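import Mathlib
import Summits.CriticalPhenomena.CardyFormulaZ2.Theorems.CardySelfRefinementGradientComparabilityStubSlopeBoundsStageA
import Summits.CriticalPhenomena.CardyFormulaZ2.Theorems.CardySelfRefinementGradientComparabilityStubSlopeBoundsTransferBulk
import Summits.CriticalPhenomena.CardyFormulaZ2.Theorems.CardySelfRefinementGradientComparabilityStubDcEqSumPivotal
import HarnessLib

/-!
# Slope bounds, bulk clause: assembly from the `c`-range (C) and the boundary-layer bound (D)

Crux `stmt-CriticalPhenomena-10269`
(`Summit.CriticalPhenomena.CardyFormulaZ2.Theses.CardySelfRefinement.GradientComparability`),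
line `monotone-product-coordinates`, registered sub-goal
`slopeBounds_bulk_of_cRange_of_layerBound` of the stub `stub_slopeBounds` (first-order slope
bounds): the BULK clause `|∂ρP| ≤ C · ∂cP` at the path points `ρ ≤ 1 - δ`, assembled from its two
remaining inputs taken as hypotheses — (C) the `c`-range of the bulk path points
(`bulkPathPoints_cRange`) and (D) the boundary-layer bound (`axialLayer_pivotal_le`) — and the
landed Stage A (`Drho_abs_le_sum_axial_pivotal`), Stage B (`nonAxialShare_bulk_M`) and the Russo
dictionary in the `c`-direction (`stub_Dc_eq_sum_pivotal`).  Vocabulary (`ax M Aloc window edgeOf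
Dρ Dc PathOK`) from `CardySelfRefinementDefs`.

## Mathematics

Fix `k ∈ {2,3}`, an admissible path `γ`, a quad family `F` (`0 < m`) and `δ > 0`.  (C) gives
`0 < c_lo`, `c_hi < 1` with `c_s ∈ [c_lo, c_hi]` at every bulk path point (`ρ_s ≤ 1 - δ`); (D)
gives `r > 0`, `C_D`, `η_D > 0`; Stage B with this `r` gives `c₁ > 0`, `η₄ > 0`.  For a mesh
`η < min η_D η₄` and a bulk path point `(ρ, c) = γ s` write `Pv e = M_k(ρ,c)(e pivotal for Aloc)`.
Stage A: `|∂ρP| ≤ (2^k/δ) Σ_{W} Pv`, `W` = axial window edges.  Split `W` into the layer part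
`W_l` (an endpoint within `r` of a side of a quad) and the far part (`⊆ W_b`, all window edges
`r`-far from every side).  Stage B: `c₁ Σ_{W_b} Pv ≤ Σ_{W'} Pv` for a finite set `W'` of non-axial
edges, and `Σ_{W'} Pv ≤ Σ_{W_n} Pv` (`W_n` = non-axial window edges; edges off the window are never
pivotal for `Aloc`); (D): `Σ_{W_l} Pv ≤ C_D Σ_{W_n} Pv`; dictionary: `Σ_{W_n} Pv = ∂cP`.  Hence
`|∂ρP| ≤ (2^k/δ)(1/c₁ + max C_D 0) ∂cP` (Grimmett 1999, Thm. 2.25: Russo's formula; the constant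
is uniform in the mesh and along the bulk part of the path).
-/

noncomputable section

namespace Summit.CriticalPhenomena.CardyFormulaZ2.Theorems.CardySelfRefinement

open scoped Topology
open Filter Set MeasureTheory
open Literature.Probability.LatticeModels Literature.Probability.Percolation
open Literature.Probability.Percolation.QuadCrossing
open Summit.CriticalPhenomena.CardyFormulaZ2.Theses.CardySelfRefinement

/-- Pivotal probabilities summed over a finite set of edges do not see the edges off the window:
if every edge of `W'` lying in the window belongs to `Wn`, then `Σ_{W'} ≤ Σ_{Wn}`. -/
theorem sum_real_isPivotal_le_of_window_subset (k m : ℕ) (F : Fin m → Quad (Set.univ : Set ℂ))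
    (η ρ c : ℝ) {W' Wn : Finset (Sym2 (Site 2))} (h : ∀ e ∈ W', e ∈ window m F η → e ∈ Wn) :
    ∑ e ∈ W', (M k ρ c).real {ω | IsPivotal (Aloc m F η) e ω} ≤
      ∑ e ∈ Wn, (M k ρ c).real {ω | IsPivotal (Aloc m F η) e ω} := by
  classical
  have hzero : ∀ e ∈ W', e ∉ window m F η →
      (M k ρ c).real {ω | IsPivotal (Aloc m F η) e ω} = 0 := by
    intro e _ he
    have hempty : {ω | IsPivotal (Aloc m F η) e ω} = (∅ : Set (BondConfig (Site 2))) :=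
      Set.eq_empty_of_forall_notMem fun ω => not_isPivotal_Aloc_of_notMem_window m F η he ω
    rw [hempty, measureReal_empty]
  calc ∑ e ∈ W', (M k ρ c).real {ω | IsPivotal (Aloc m F η) e ω}
      = ∑ e ∈ W'.filter (fun e => e ∈ window m F η),
          (M k ρ c).real {ω | IsPivotal (Aloc m F η) e ω} := by
        rw [Finset.sum_filter]
        refine Finset.sum_congr rfl fun e he => ?_
        split_ifs with hw
        · rfl
        · exact hzero e he hw
    _ ≤ ∑ e ∈ Wn, (M k ρ c).real {ω | IsPivotal (Aloc m F η) e ω} := by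
        refine Finset.sum_le_sum_of_subset_of_nonneg (fun e he => ?_)
          fun _ _ _ => measureReal_nonneg
        obtain ⟨he, hw⟩ := Finset.mem_filter.1 he
        exact h e he hw

/-- **BULK CLAUSE of `stub_slopeBounds`, assembled** (registered sub-goal
`slopeBounds_bulk_of_cRange_of_layerBound`): the `c`-range of the bulk path points (C) and the
boundary-layer bound (D) imply, for `k ∈ {2,3}`, every admissible path `γ`, every quad family `F`
(`0 < m`) and every `δ ∈ (0, ½]`, constants `C`, `η₁ > 0` with
`|∂ρP(γ s)| ≤ C · ∂cP(γ s)` for every mesh `η ∈ (0, η₁)` and every path point with `ρ_s ≤ 1 - δ`. -/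
theorem slopeBounds_bulk_of_cRange_of_layerBound : (∀ k : ℕ, k = 2 ∨ k = 3 → ∀ γ : unitInterval → ℝ × ℝ, PathOK k γ → ∀ δ : ℝ, 0 < δ → ∃ cl ch : ℝ, 0 < cl ∧ ch < 1 ∧ ∀ s : unitInterval, (γ s).1 ≤ 1 - δ → (γ s).2 ∈ Set.Icc cl ch) → (∀ k : ℕ, k = 2 ∨ k = 3 → ∀ (m : ℕ) (F : Fin m → Quad (Set.univ : Set ℂ)), 0 < m → ∀ δ cl ch : ℝ, 0 < δ → 0 < cl → ch < 1 → ∃ r C η₁ : ℝ, 0 < r ∧ 0 < η₁ ∧ ∀ η ∈ Set.Ioo 0 η₁, ∀ ρ ∈ Set.Icc (0 : ℝ) (1 - δ), ∀ c ∈ Set.Icc cl ch, ∀ Wl Wn : Finset (Sym2 (Site 2)), (∀ e, e ∈ Wl ↔ e ∈ window m F η ∧ (∃ (v : Site 2) (d : Fin 2), e = edgeOf (v, d) ∧ ax k (v, d)) ∧ ∃ x ∈ e, ∃ (i : Fin m) (j : Fin 4), ∃ p ∈ (F i).side j, dist ((η : ℂ) * squareLatticeEmbedding.z x) p < r) → (∀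 e, e ∈ Wn ↔ e ∈ window m F η ∧ ∃ (v : Site 2) (d : Fin 2), e = edgeOf (v, d) ∧ ¬ ax k (v, d)) → ∑ e ∈ Wl, (M k ρ c).real {ω | IsPivotal (Aloc m F η) e ω} ≤ C * ∑ e ∈ Wn, (M k ρ c).real {ω | IsPivotal (Aloc m F η) e ω}) → ∀ k : ℕ, k = 2 ∨ k = 3 → ∀ γ : unitInterval → ℝ × ℝ, PathOK k γ → ∀ (m : ℕ) (F : Fin m → Quad (Set.univ : Set ℂ)), 0 < m → ∀ δ : ℝ, 0 < δ → δ ≤ 1 / 2 → ∃ C η₁ : ℝ, 0 < η₁ ∧ ∀ η ∈ Set.Ioo 0 η₁, ∀ s : unitInterval, (γ s).1 ≤ 1 - δ → |Dρ k m F η (γ s)| ≤ C * Dc k m F η (γ s) := by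
  intro hC hD k hk γ hγ m F hm δ hδ _
  classical
  -- the constants
  obtain ⟨cl, ch, hcl, hch, hcs⟩ := hC k hk γ hγ δ hδ
  obtain ⟨r, CD, ηD, hr, hηD, hDD⟩ := hD k hk m F hm δ cl ch hδ hcl hch
  obtain ⟨c₁, η₄, hc₁, hη₄, hBB⟩ := nonAxialShare_bulk_M k hk m F r hr δ cl ch hδ hcl hch
  have hk0 : 0 < k := by rcases hk with rfl | rfl <;> norm_num
  refine ⟨2 ^ k / δ * (1 / c₁ + max CD 0), min ηD η₄, lt_min hηD hη₄, fun η hη s hs => ?_⟩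
  have hη0 : 0 < η := hη.1
  have hηne : η ≠ 0 := hη0.ne'
  have hηD' : η ∈ Set.Ioo 0 ηD := ⟨hη0, lt_of_lt_of_le hη.2 (min_le_left _ _)⟩
  have hη4' : η ∈ Set.Ioo 0 η₄ := ⟨hη0, lt_of_lt_of_le hη.2 (min_le_right _ _)⟩
  -- the path point `(ρ, c) = γ s`
  have hc : (γ s).2 ∈ Set.Icc cl ch := hcs s hs
  have hq01 : γ s ∈ Set.Icc (0 : ℝ) 1 ×ˢ Set.Icc (0 : ℝ) 1 := hγ.2.2.2.1 s
  generalize hq : γ s = q at hs hc hq01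
  obtain ⟨ρ, c⟩ := q
  dsimp only at hs hc
  have hρ : ρ ∈ Set.Icc (0 : ℝ) (1 - δ) := ⟨(Set.mem_prod.1 hq01).1.1, hs⟩
  have hc01 : c ∈ Set.Icc (0 : ℝ) 1 := ⟨hcl.le.trans hc.1, hc.2.trans hch.le⟩
  -- the four finite sets of window edges
  have hfin : (window m F η).Finite := window_finite m F hηne
  obtain ⟨W, hW_def⟩ : ∃ W : Finset (Sym2 (Site 2)), W = hfin.toFinset.filter
      (fun e => ∃ (v : Site 2) (d : Fin 2), e = edgeOf (v, d) ∧ ax k (v, d)) := ⟨_, rfl⟩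
  obtain ⟨Wn, hWn_def⟩ : ∃ Wn : Finset (Sym2 (Site 2)), Wn = hfin.toFinset.filter
      (fun e => ∃ (v : Site 2) (d : Fin 2), e = edgeOf (v, d) ∧ ¬ ax k (v, d)) := ⟨_, rfl⟩
  obtain ⟨Wl, hWl_def⟩ : ∃ Wl : Finset (Sym2 (Site 2)), Wl = W.filter
      (fun e => ∃ x ∈ e, ∃ (i : Fin m) (j : Fin 4), ∃ p ∈ (F i).side j,
        dist ((η : ℂ) * squareLatticeEmbedding.z x) p < r) := ⟨_, rfl⟩
  obtain ⟨Wb, hWb_def⟩ : ∃ Wb : Finset (Sym2 (Site 2)), Wb = hfin.toFinset.filter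
      (fun e => ∀ x ∈ e, ∀ (i : Fin m) (j : Fin 4), ∀ p ∈ (F i).side j,
        r ≤ dist ((η : ℂ) * squareLatticeEmbedding.z x) p) := ⟨_, rfl⟩
  have hW : ∀ e, e ∈ W ↔ e ∈ window m F η ∧
      ∃ (v : Site 2) (d : Fin 2), e = edgeOf (v, d) ∧ ax k (v, d) := fun e => by
    rw [hW_def, Finset.mem_filter, Set.Finite.mem_toFinset]
  have hWn : ∀ e, e ∈ Wn ↔ e ∈ window m F η ∧
      ∃ (v : Site 2) (d : Fin 2), e = edgeOf (v, d) ∧ ¬ ax k (v, d) := fun e => by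
    rw [hWn_def, Finset.mem_filter, Set.Finite.mem_toFinset]
  have hWl : ∀ e, e ∈ Wl ↔ e ∈ window m F η ∧
      (∃ (v : Site 2) (d : Fin 2), e = edgeOf (v, d) ∧ ax k (v, d)) ∧
        ∃ x ∈ e, ∃ (i : Fin m) (j : Fin 4), ∃ p ∈ (F i).side j,
          dist ((η : ℂ) * squareLatticeEmbedding.z x) p < r := fun e => by
    rw [hWl_def, Finset.mem_filter, hW, and_assoc]
  have hWb : ∀ e, e ∈ Wb ↔ e ∈ window m F η ∧
      ∀ x ∈ e, ∀ (i : Fin m) (j : Fin 4), ∀ p ∈ (F i).side j,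
        r ≤ dist ((η : ℂ) * squareLatticeEmbedding.z x) p := fun e => by
    rw [hWb_def, Finset.mem_filter, Set.Finite.mem_toFinset]
  have hWb_coe : (↑Wb : Set (Sym2 (Site 2))) = {e ∈ window m F η |
      ∀ x ∈ e, ∀ (i : Fin m) (j : Fin 4), ∀ p ∈ (F i).side j,
        r ≤ dist ((η : ℂ) * squareLatticeEmbedding.z x) p} := by
    ext e
    rw [Finset.mem_coe, hWb, Set.mem_setOf_eq]
  -- abbreviation of the pivotal probabilities
  obtain ⟨Pv, hPv⟩ : ∃ Pv : Sym2 (Site 2) → ℝ,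
      ∀ e, (M k ρ c).real {ω | IsPivotal (Aloc m F η) e ω} = Pv e := ⟨_, fun _ => rfl⟩
  have hPv0 : ∀ e, 0 ≤ Pv e := fun e => by rw [← hPv]; exact measureReal_nonneg
  -- Stage A
  have hA : |Dρ k m F η (ρ, c)| ≤ 2 ^ k / δ * ∑ e ∈ W, Pv e := by
    have h := Drho_abs_le_sum_axial_pivotal k hk0 m F hηne δ hδ ρ hρ c W hW
    simp only [hPv] at h
    exact h
  -- the Russo dictionary in the `c`-direction
  have hDc : Dc k m F η (ρ, c) = ∑ e ∈ Wn, Pv e := by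
    have h := stub_Dc_eq_sum_pivotal k m F hηne ρ hc01 Wn hWn
    simp only [hPv] at h
    exact h
  -- (D): the boundary layer
  have hlayer : ∑ e ∈ Wl, Pv e ≤ CD * ∑ e ∈ Wn, Pv e := by
    have h := hDD η hηD' ρ hρ c hc Wl Wn hWl hWn
    simp only [hPv] at h
    exact h
  -- Stage B: the far part
  have hfar : c₁ * ∑ e ∈ Wb, Pv e ≤ ∑ e ∈ Wn, Pv e := by
    obtain ⟨W', hW', hle⟩ := hBB η hη4' ρ hρ c hc Wb hWb_coe
    have hW'n : ∀ e ∈ W', e ∈ window m F η → e ∈ Wn := fun e he hw => (hWn e).2 ⟨hw, hW' e he⟩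
    have h := hle.trans (sum_real_isPivotal_le_of_window_subset k m F η ρ c hW'n)
    simp only [hPv] at h
    exact h
  -- splitting the axial window edges into layer and far part
  have hsplit : ∑ e ∈ W, Pv e ≤ ∑ e ∈ Wl, Pv e + ∑ e ∈ Wb, Pv e := by
    rw [hWl_def, ← Finset.sum_filter_add_sum_filter_not W (fun e => ∃ x ∈ e, ∃ (i : Fin m) (j : Fin 4),
      ∃ p ∈ (F i).side j, dist ((η : ℂ) * squareLatticeEmbedding.z x) p < r) Pv]
    refine add_le_add le_rfl
      (Finset.sum_le_sum_of_subset_of_nonneg (fun e he => ?_) fun e _ _ => hPv0 e)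
    rw [Finset.mem_filter] at he
    rw [hWb]
    refine ⟨((hW e).1 he.1).1, fun x hx i j p hp => not_lt.1 fun hlt => he.2 ⟨x, hx, i, j, p, hp, hlt⟩⟩
  -- arithmetic
  have hS0 : 0 ≤ ∑ e ∈ Wn, Pv e := Finset.sum_nonneg fun e _ => hPv0 e
  have hWb_le : ∑ e ∈ Wb, Pv e ≤ 1 / c₁ * ∑ e ∈ Wn, Pv e := by
    rw [one_div, ← div_eq_inv_mul, le_div_iff₀ hc₁, mul_comm]
    exact hfar
  have hWl_le : ∑ e ∈ Wl, Pv e ≤ max CD 0 * ∑ e ∈ Wn, Pv e :=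
    hlayer.trans (mul_le_mul_of_nonneg_right (le_max_left _ _) hS0)
  have hK0 : 0 ≤ (2 : ℝ) ^ k / δ := by positivity
  calc |Dρ k m F η (ρ, c)| ≤ 2 ^ k / δ * ∑ e ∈ W, Pv e := hA
    _ ≤ 2 ^ k / δ * ((1 / c₁ + max CD 0) * ∑ e ∈ Wn, Pv e) := by
        refine mul_le_mul_of_nonneg_left ?_ hK0
        calc ∑ e ∈ W, Pv e ≤ ∑ e ∈ Wl, Pv e + ∑ e ∈ Wb, Pv e := hsplit
          _ ≤ max CD 0 * ∑ e ∈ Wn, Pv e + 1 / c₁ * ∑ e ∈ Wn, Pv e := add_le_add hWl_le hWb_le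
          _ = (1 / c₁ + max CD 0) * ∑ e ∈ Wn, Pv e := by ring
    _ = 2 ^ k / δ * (1 / c₁ + max CD 0) * Dc k m F η (ρ, c) := by rw [hDc]; ring

end Summit.CriticalPhenomena.CardyFormulaZ2.Theorems.CardySelfRefinement

end
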